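import Summits.MatrixMultiplication.MatrixMultiplication.Theses.SaturationLadder
import Summits.MatrixMultiplication.MatrixMultiplication.Theorems.SaturationLadderGradeOneThirdCertDiagonal
import Summits.MatrixMultiplication.MatrixMultiplication.Theorems.SaturationLadderExpSaturationEntropy

/-!
# `ω(5, 1, 3) ≤ 8` — the grade-`1/3` certificate of route `SaturationLadder` (items
stmt-MatrixMultiplication-25914 `GradeOneThirdCert`, hence 24105 `GradeOneThird`, 24106 `GradeRow033`)

Decomposition cell `decomp-mm`, lens 1 (grading / quantitative ladder), generation 3.  PROOF, 0 sorry,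
of the aside `GradeOneThirdCert : omegaRect ℂ 5 1 3 ≤ 8` of
`Summits/MatrixMultiplication/MatrixMultiplication/Theses/SaturationLadder.lean`, i.e. the information
bound `ω(1, t, r) ≥ 1 + r` is TIGHT at `(t, r) = (1/3, 5/3)`: `ω(1, 1/3, 5/3) = 8/3`
(homogeneity + symmetry: `ω(5,1,3) = 3 · ω(5/3, 1/3, 1) = 3 · ω(1, 1/3, 5/3)`).

The proof is the FIRST-POWER laser method on the Coppersmith–Winograd tensor `CW_8`
(`R̃(CW_8) ≤ 10`), run through the tree's proved pipeline for crux `PerfectAmortisation`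
(`Theorems/ShapeSubmodularityPerfectAmortisation*.lean`) with a DIFFERENT joint type and the
general-format asymptotic sum inequality of the tree (`advxxz2025_thm32`,
`AsymptoticRankMultiplesMatMul.lean` — the ingredient the g2 node card listed as "missing"; it is not):

* joint type `Q = (5m on (1,1,0), m on (0,1,1), 3m on (1,0,1), m on (2,0,0))`, `N = 10m`,
  `P = Q/N = (5, 1, 3, 1)/10`; marginals `X = (1, 8, 1)/10`, `Y = (4, 6, 0)/10`, `Z = (6, 4, 0)/10`;
* `stub_cwRectRestriction` (tree): a free diagonal `Δ` of that type gives
  `CW_8^{⊗N} ≥ ⟨|Δ|⟩ ⊗ ⟨8^{5m}, 8^{m}, 8^{3m}⟩` (the `(2,0,0)` blocks `x_{q+1} y_0 z_0` are trivial);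
* `exists_free_diagonal_jointType_card` (tree, Le Gall 2014 App. A): a free `Δ` with
  `2^{N (min_m H(P_m) − Γ_S(P))} ≤ |Δ| · (N+1)^63 · 192 · exp(4 √(log 6 + N log 27))`;
* entropy evaluation (this file): `min_m H(P_m) = H(X) = log 10 − (8/10) log 8` (nats) because
  `H(Y) = H(Z) = h(4/10) ≥ H(X)` ⟺ `3 log 3 ≤ 5 log 2` ⟺ `27 ≤ 32`, and `Γ_S(P) = 0` because a law on
  `{i+j+l = 2}` with these marginals has no mass on `(0,2,0), (0,0,2)` and is then determined
  (`D(P) = {P}`);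
* PERFECTNESS: `N · H(X) = 10m log 10 − 8m log 8`, so `10^N = exp(N H(X)) · (8^m)^8` EXACTLY and the
  packing certificate reads `10^N ≤ |Δ| · (8^m)^{8+δ}` for `m ≥ m₀(δ)`;
* `advxxz2025_thm32` (tree, ADVXXZ 2025 Thm. 3.2): `|Δ| · (8^m)^{ω(5,1,3)} ≤ R̃(⟨|Δ|⟩ ⊗ ⟨(8^m)^5, 8^m, (8^m)^3⟩)
  ≤ R̃(CW_8^{⊗N}) ≤ 10^N`, whence `ω(5,1,3) ≤ 8 + δ` for every `δ > 0`.

Corollaries: the route items `GradeOneThirdCert` (25914), `GradeOneThird` (24105, `T(1/3, 5/3)`),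
`GradeRow033` (24106, `T(0.33, 5/3)` by monotonicity in the middle slot).

References: Coppersmith–Winograd 1990 §6–§7; Le Gall, *Powers of tensors and fast matrix
multiplication*, ISSAC 2014, App. A [LeGall2014]; Alman–Duan–Vassilevska Williams–Xu–Xu–Zhou,
SODA 2025, Thm. 3.2 [AlmanDuanVassilevskaWilliamsXuXuZhou2025]; Huang–Pan 1998 §2 (2.8) (the
information bound `ω(1,t,r) ≥ 1+r`) [HuangPan1998]; Lotti–Romani 1983 (homogeneity) [LottiRomani1983].
No new definitions, no named facts, no sorry.

Landing note: the lens-1 kernel `GradeOneThirdCert.lean` (decomp-mm gen 3; sha256 7a2649f7…, 560 lines, rc 0 ·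
0 sorry · std axioms, re-probed rc 0 by critic 03:41:21Z and census-trib-mm-2 03:50:47Z) is landed as two files for
the gate rule «Theorems files with proofs ≤ 400 lines» — `SaturationLadderGradeOneThirdCertDiagonal` (layers B1,
B2: free diagonal of the joint type `(5m, m, 3m, m)`, entropy evaluation of the law `(5,1,3,1)/10`, `cw8Diagonal`)
and `SaturationLadderGradeOneThirdCert` (layer C `cw8Threshold`, assembly `ω(5,1,3) ≤ 8`, the closers
`gradeOneThirdCert_holds` / `gradeOneThird_holds` / `gradeRow033_holds`); statements and proofs unchanged (one
namespace `…Theorems.SaturationLadderGradeOneThirdCert`), except that, of the four small lemmas this kernel shared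
verbatim with the sibling kernel `ExpSaturation.lean`, `loss_le_exp'` is imported from the landed route-free
`Theorems/SaturationLadderExpSaturationEntropy.lean` and `asymptoticRank_multiple_matMulTensor_congr`,
`rectAdmissibleExponents_anti`, `omegaRect_mono'` are local `have`s at their single uses (not restated; no import of
the route-importing `Theorems/SaturationLadderExpSaturation.lean`, gate lint `theses-cone`), and `log 4 = 2 log 2`,
`log 6 = log 2 + log 3`, `log 8 = 3 log 2` (= the landed `Literature.NumberTheory.LFunctions.FordLambda.log_{4,6,8}_eq`)
are one-line local `have`s at their two uses
(gate rule `dedup.landed`); the helper file imports no route (`Theses`) file (gate lint `theses-cone`).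
-/

set_option linter.dupNamespace false
-- (single-conjunct summit: the namespace repeats `MatrixMultiplication`)

noncomputable section

open Finset
open scoped BigOperators

namespace Summit.MatrixMultiplication.MatrixMultiplication.Theorems.SaturationLadderGradeOneThirdCert

open Literature.Computability.AlgebraicComplexity
open Literature.Barriers.MatrixMultiplication
open Summit.MatrixMultiplication.MatrixMultiplication.Theorems.PerfectAmortisation
  (stub_cwRectRestriction)
open Summit.MatrixMultiplication.MatrixMultiplication.Theorems.SaturationLadderExpSaturation
  (loss_le_exp')  -- shared with the sibling kernel `ExpSaturation`, imported from its landed (route-free) file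

/-! ## Layer C — the analytic threshold (perfectness: `10^N = exp(N H_X) · (8^m)^8` exactly) -/

/-- **Analytic threshold.**  For `δ > 0` there is `m ≥ 1` such that, with `N = 10 m`, every `V : ℕ`
with `exp(N · (log 10 − (8/10) log 8)) ≤ V · (N+1)^63 · 192 · exp(4 √(log 6 + N log 27))` satisfies
the packing certificate `10^N ≤ V · (8^m)^(8 + δ)`.  The point: `N (log 10 − (8/10) log 8) + 8 m log 8
= 10 m log 10` EXACTLY (the joint type is `X`-perfect), so only the subexponential loss has to be
absorbed into `(8^m)^δ` (`loss_le_exp'`, `exists_nat_forall_sqrt_le`). [folklore] -/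
theorem cw8Threshold :
    ∀ δ : ℝ, 0 < δ → ∃ m : ℕ, 1 ≤ m ∧ ∀ V : ℕ,
      Real.exp ((((10 * m : ℕ)) : ℝ) * (Real.log 10 - 8 / 10 * Real.log 8)) ≤
          (V : ℝ) * ((((10 * m : ℕ)) : ℝ) + 1) ^ 63 * 192 *
            Real.exp (4 * Real.sqrt (Real.log 6 + (((10 * m : ℕ)) : ℝ) * Real.log 27)) →
      (10 : ℝ) ^ (10 * m) ≤ (V : ℝ) * ((8 : ℝ) ^ m) ^ ((8 : ℝ) + δ) := by
  intro δ hδ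
  have hL : 0 < Real.log (8 : ℝ) := Real.log_pos (by norm_num)
  -- the threshold
  obtain ⟨m₀, hm₀⟩ := exists_nat_forall_sqrt_le
    (126 * √((8 : ℝ) + 3) + 4 * √(Real.log 6 + ((8 : ℝ) + 2) * Real.log 27)) (Real.log 192)
    (δ * Real.log (8 : ℝ)) (mul_pos hδ hL)
  obtain ⟨m, hm1, hmm⟩ : ∃ m : ℕ, 1 ≤ m ∧
      (126 * √((8 : ℝ) + 3) + 4 * √(Real.log 6 + ((8 : ℝ) + 2) * Real.log 27)) * √(m : ℝ) +
        Real.log 192 ≤ δ * Real.log (8 : ℝ) * m :=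
    ⟨max m₀ 1, le_max_right _ _, hm₀ _ (le_max_left _ _)⟩
  refine ⟨m, hm1, fun V hV => ?_⟩
  have hM1 : (1 : ℝ) ≤ m := by exact_mod_cast hm1
  have hN : (((10 * m : ℕ)) : ℝ) = ((8 : ℝ) + 2) * m := by push_cast; ring
  rw [hN] at hV
  set h : ℝ := Real.log 10 - 8 / 10 * Real.log 8 with hh_def
  -- Step 1: the loss is at most `exp (δ m log 8)`, hence `exp (N h) ≤ V exp (δ m log 8)`
  have hloss := loss_le_exp' (by norm_num : (0 : ℝ) ≤ 8) hM1 hmm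
  have hmain : Real.exp (((8 : ℝ) + 2) * m * h) ≤ (V : ℝ) * Real.exp (δ * Real.log (8 : ℝ) * m) :=
    calc Real.exp (((8 : ℝ) + 2) * m * h)
        ≤ (V : ℝ) * (((8 : ℝ) + 2) * m + 1) ^ 63 * 192 *
            Real.exp (4 * √(Real.log 6 + ((8 : ℝ) + 2) * m * Real.log 27)) := hV
      _ = (V : ℝ) * ((((8 : ℝ) + 2) * m + 1) ^ 63 * 192 *
            Real.exp (4 * √(Real.log 6 + ((8 : ℝ) + 2) * m * Real.log 27))) := by
          rw [mul_assoc (V : ℝ), mul_assoc (V : ℝ)]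
      _ ≤ (V : ℝ) * Real.exp (δ * Real.log (8 : ℝ) * m) :=
          mul_le_mul_of_nonneg_left hloss (Nat.cast_nonneg V)
  -- Step 2: `10^N = exp (N h) · exp (8 m log 8)` and `(8^m)^(8+δ) = exp (δ m log 8) · exp (8 m log 8)`
  have h8m : (0 : ℝ) < (8 : ℝ) ^ m := by positivity
  have h10 : (10 : ℝ) ^ (10 * m) = Real.exp (((8 : ℝ) + 2) * m * h) * Real.exp (8 * m * Real.log 8) := by
    rw [← Real.exp_add, ← Real.exp_log (by positivity : (0 : ℝ) < 10 ^ (10 * m)), Real.log_pow]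
    congr 1
    rw [hh_def]
    push_cast
    ring
  have hexp8 : ((8 : ℝ) ^ m) ^ ((8 : ℝ) + δ) =
      Real.exp (δ * Real.log (8 : ℝ) * m) * Real.exp (8 * m * Real.log 8) := by
    rw [Real.rpow_def_of_pos h8m, Real.log_pow, ← Real.exp_add]
    congr 1
    ring
  rw [h10, hexp8, ← mul_assoc]
  exact mul_le_mul_of_nonneg_right hmain (Real.exp_pos _).le

/-! ## Assembly: `ω(5,1,3) ≤ 8` -/

/-- **`ω(5, 1, 3) ≤ 8`** — the first-power `CW_8` laser method with joint type `(5,1,3,1)/10`: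
for every `δ > 0`, `|Δ| · (8^m)^{ω(5,1,3)} ≤ R̃(⟨|Δ|⟩ ⊗ ⟨8^{5m}, 8^m, 8^{3m}⟩) ≤ R̃(CW_8^{⊗10m})
≤ 10^{10m} ≤ |Δ| · (8^m)^{8+δ}`. [cite: AlmanDuanVassilevskaWilliamsXuXuZhou2025, Thm. 3.2]
[cite: LeGall2014, Appendix A] -/
theorem omegaRect_five_one_three_le : omegaRect ℂ 5 1 3 ≤ 8 := by
  -- Transport of `R̃(⟨V⟩ ⊗ ⟨k,l,n⟩)` along equalities of the dimensions (the sibling kernel's landed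
  -- `SaturationLadderExpSaturation.asymptoticRank_multiple_matMulTensor_congr`, kept local so that this file does
  -- not build on a route-importing module; gate lint `theses-cone`, rule `dedup.landed`).
  have asymptoticRank_multiple_matMulTensor_congr : ∀ {V k k' l l' n n' : ℕ}, k = k' → l = l' → n = n' →
      asymptoticRank (kroneckerTensor (unitTensor ℂ V) (matMulTensor ℂ k l n)) =
        asymptoticRank (kroneckerTensor (unitTensor ℂ V) (matMulTensor ℂ k' l' n')) := by
    intro V k k' l l' n n' hk hl hn; subst hk; subst hl; subst hn; rfl
  refine le_of_forall_pos_lt_add fun δ hδ => ?_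
  obtain ⟨m, hm, hT⟩ := cw8Threshold (δ / 2) (half_pos hδ)
  obtain ⟨Δ, hS, hcnt, hfree, hsize⟩ := cw8Diagonal m hm
  have hres := stub_cwRectRestriction 8 (m * 5) m (m * 3) (10 * m) Δ hS hcnt hfree
  have hV : 1 ≤ Δ.card := by
    by_contra h0
    have h0' : Δ.card = 0 := by omega
    rw [h0', Nat.cast_zero, zero_mul, zero_mul, zero_mul] at hsize
    exact absurd hsize (not_le.2 (Real.exp_pos _))
  have hnum := hT Δ.card hsize
  have hm0 : m ≠ 0 := by omega
  have h8le : 8 ≤ 8 ^ m := Nat.le_self_pow hm0 8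
  have hq : 2 ≤ 8 ^ m := le_trans (by norm_num) h8le
  -- the general-format asymptotic sum inequality (ADVXXZ 2025, Thm. 3.2) at `q = 8^m`, `(a,b,c) = (5,1,3)`
  have hasi := advxxz2025_thm32 ℂ hq 5 1 3 hV
  rw [asymptoticRank_multiple_matMulTensor_congr (pow_mul 8 m 5).symm (pow_one (8 ^ m))
    (pow_mul 8 m 3).symm] at hasi
  push_cast at hasi
  -- `R̃(⟨V⟩ ⊗ ⟨8^{5m}, 8^m, 8^{3m}⟩) ≤ R̃(CW_8^{⊗N}) ≤ 10^N`
  have h2 := asymptoticRank_le_of_polyDegeneratesTo hres.polyDegeneratesTo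
  have hcw : asymptoticRank (bigCwTensor ℂ 8) ≤ (8 : ℝ) + 2 := by
    exact_mod_cast asymptoticRank_bigCwTensor_le ℂ 8
  have hNpos : 0 < 10 * m := by omega
  have h3 : asymptoticRank (kroneckerPow (bigCwTensor ℂ 8) (10 * m)) ≤ (10 : ℝ) ^ (10 * m) := by
    have h := (asymptoticRank_kroneckerPow_le (bigCwTensor ℂ 8) hNpos).trans
      (pow_le_pow_left₀ (asymptoticRank_nonneg _) hcw (10 * m))
    norm_num at h
    exact h
  have hchain : (Δ.card : ℝ) * ((8 : ℝ) ^ m) ^ omegaRect ℂ 5 1 3 ≤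
      (Δ.card : ℝ) * ((8 : ℝ) ^ m) ^ ((8 : ℝ) + δ / 2) :=
    hasi.trans (h2.trans (h3.trans hnum))
  have hV0 : (0 : ℝ) < Δ.card := by exact_mod_cast hV
  have h4 : ((8 : ℝ) ^ m) ^ omegaRect ℂ 5 1 3 ≤ ((8 : ℝ) ^ m) ^ ((8 : ℝ) + δ / 2) :=
    le_of_mul_le_mul_left hchain hV0
  have h81 : (1 : ℝ) < (8 : ℝ) ^ m := by
    have h8 : (8 : ℝ) ≤ (8 : ℝ) ^ m := by exact_mod_cast h8le
    linarith
  have h5 : omegaRect ℂ 5 1 3 ≤ 8 + δ / 2 := (Real.rpow_le_rpow_left_iff h81).1 h4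
  linarith

/-! ## The route items -/

/-- **Item stmt-MatrixMultiplication-25914 `GradeOneThirdCert`** (`ω(5,1,3) ≤ 8`), by name.
[cite: AlmanDuanVassilevskaWilliamsXuXuZhou2025, Thm. 3.2] -/
theorem gradeOneThirdCert_holds :
    Summit.MatrixMultiplication.MatrixMultiplication.Theses.SaturationLadder.GradeOneThirdCert :=
  omegaRect_five_one_three_le

/-- **Item stmt-MatrixMultiplication-24105 `GradeOneThird`** (`∃ r ≥ 1, ω(1, 1/3, r) ≤ 1 + r`; witness
`r = 5/3`): `ω(5,1,3) = 3 · ω(5/3, 1/3, 1)` (homogeneity, Lotti–Romani 1983) `= 3 · ω(1, 1/3, 5/3)`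
(symmetry), so `ω(1, 1/3, 5/3) ≤ 8/3 = 1 + 5/3`. [cite: LottiRomani1983, §1 (p. 173)] -/
theorem gradeOneThird_holds :
    Summit.MatrixMultiplication.MatrixMultiplication.Theses.SaturationLadder.GradeOneThird := by
  have h := omegaRect_five_one_three_le
  have hhom := LottiRomani1983_homogeneous ℂ (by norm_num : (0 : ℝ) ≤ 3)
    (by norm_num : (0 : ℝ) ≤ 5 / 3) (by norm_num : (0 : ℝ) ≤ 1 / 3) zero_le_one
  have e : omegaRect ℂ 5 1 3 = omegaRect ℂ (3 * (5 / 3)) (3 * (1 / 3)) (3 * 1) := by norm_num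
  have h' : omegaRect ℂ (5 / 3) (1 / 3) 1 ≤ 8 / 3 := by
    have : 3 * omegaRect ℂ (5 / 3) (1 / 3) 1 ≤ 8 := by
      rw [← hhom, ← e]; exact h
    linarith
  rw [omegaRect_swap₁₃] at h'
  exact ⟨5 / 3, by norm_num, by linarith⟩

/-- **Item stmt-MatrixMultiplication-24106 `GradeRow033`** (`∃ r ≥ 1, ω(1, 0.33, r) ≤ 1 + r`;
witness `r = 5/3`, from `GradeOneThird` by monotonicity in the middle slot, `0.33 ≤ 1/3`).
[cite: VassilevskaWilliamsXuXuZhou2024, Table 1] -/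
theorem gradeRow033_holds :
    Summit.MatrixMultiplication.MatrixMultiplication.Theses.SaturationLadder.GradeRow033 := by
  -- `ω(a,b,c)` is monotone in the format exponents (the sibling kernel's landed
  -- `SaturationLadderExpSaturation.rectAdmissibleExponents_anti` / `omegaRect_mono'`, kept local so that this file
  -- does not build on a route-importing module; gate lint `theses-cone`, rule `dedup.landed`).
  have rectAdmissibleExponents_anti : ∀ {a a' b b' c c' : ℝ}, a ≤ a' → b ≤ b' → c ≤ c' →
      rectAdmissibleExponents ℂ a' b' c' ⊆ rectAdmissibleExponents ℂ a b c := by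
    intro a a' b b' c c' ha hb hc β hβ
    refine Asymptotics.IsBigO.trans ?_ hβ
    refine Asymptotics.IsBigO.of_bound 1 ?_
    filter_upwards [Filter.eventually_ge_atTop 1] with n hn
    rw [one_mul, Real.norm_of_nonneg (Nat.cast_nonneg _), Real.norm_of_nonneg (Nat.cast_nonneg _)]
    exact_mod_cast tensorRank_matMulTensor_mono₃ ℂ (rectDim_mono hn ha) (rectDim_mono hn hb)
      (rectDim_mono hn hc)
  have omegaRect_mono' : ∀ {a a' b b' c c' : ℝ}, a ≤ a' → b ≤ b' → c ≤ c' →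
      omegaRect ℂ a b c ≤ omegaRect ℂ a' b' c' := fun ha hb hc =>
    csInf_le_csInf (rectAdmissibleExponents_bddBelow ℂ _ _ _)
      (rectAdmissibleExponents_nonempty ℂ _ _ _) (rectAdmissibleExponents_anti ha hb hc)
  obtain ⟨r, hr, hT⟩ := gradeOneThird_holds
  exact ⟨r, hr, (omegaRect_mono' le_rfl (by norm_num) le_rfl).trans hT⟩

end Summit.MatrixMultiplication.MatrixMultiplication.Theorems.SaturationLadderGradeOneThirdCert

end
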